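import Summits.AtomisticToContinuum.Crystallization.Theorems.NashClassCertificatesNashHullBridge

/-!
# F3 WITNESS — `Rung (Set.Ioi 0)` IS the floor `NashHullBridge` (seed theorem `nashHullBridge_proof`, g1-AtomisticToContinuum-16828)

Published as `Cruxes/NashNearField/Lines/one_resolution_special.lean` next to the line skeleton
`Cruxes/NashNearField/Lines/one_resolution.lean` (forward-rung seat `fwd-rung-AtomisticToContinuum-02`).
Self-contained so that it re-elaborates standalone: the section below is the line file's §1 VERBATIM — same
namespace, same bodies (`HasWindow`, `LWConclusion`, `NashNearFieldAt`, `Rung`, `OneResolutionBridge`); do not import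
it together with the line file.  NO `sorry` in this file.

* special case : `H = Set.Ioi 0` (the near field at every positive resolution) — `rung_floor : Rung (Set.Ioi 0)` is
                 `LayeredWindowsLocal.nashHullBridge_proof` up to definitional unfolding, and `rung_floor_iff` shows the
                 floor member of the family is `NashHullBridge` on the nose.
* the rung     : `OneResolutionBridge = Rung {1/50}` implies the floor (`oneResolutionBridge_imp_floor`), and is implied by
                 the route thesis `HullMinimality.LayeredWindows` (`rung_of_layeredWindows`) — a rung strictly between the
                 proved bridge and the thesis, unless the near field at resolution 1/50 already forces all resolutions.
-/

noncomputable section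

open scoped BigOperators Classical
open Filter Topology

namespace Summit.AtomisticToContinuum.Crystallization.Cruxes.NashNearField.OneResolution

open Summit.AtomisticToContinuum.Crystallization.Theses
open Summit.AtomisticToContinuum.Crystallization.Theorems
open Summit.AtomisticToContinuum.Crystallization.Theorems.PrestressSplitKorn
open Summit.AtomisticToContinuum.Crystallization.Theorems.DefectFreeCrystallizes.Negative.PredicateAPI (Good)
open Summit.AtomisticToContinuum.Crystallization.Theorems.ChargedEnergyGapNegative (E3)
open Literature.MathematicalPhysics.StatisticalMechanics Literature.Geometry.DiscreteGeometry

/-! ### The window format of `HullMinimality.LayeredWindows` / `NashHullBridge` -/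

/-- `x : Fin N → E3` carries an `(R, ε)`-WINDOW of in-layer spacing `a`: after a translation `t`, on the ball of
radius `R` it is two-way `ε`-matched with a rigid image of a box-layered set (triangular layers of spacing
`a`, hole registry `haggLabel s`, any Hägg word `s`, interlayer increments in `[39a/50, 17a/20]`).  Body
verbatim the window clause of `NashHullBridge` / `hb_window_mono`. -/
def HasWindow {N : ℕ} (x : Fin N → E3) (a R ε : ℝ) : Prop :=
  ∃ (A : E3 →ₗᵢ[ℝ] E3) (t : E3) (s : ℤ → ℤ) (z : ℤ → ℝ), IsHaggSeq s ∧
    (∀ m : ℤ, 39 / 50 * a ≤ z (m + 1) - z m ∧ z (m + 1) - z m ≤ 17 / 20 * a) ∧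
    let S : Set E3 := {p | ∃ m i j : ℤ, p = A (((i : ℝ) • triangularVec₁ a) +
      ((j : ℝ) • triangularVec₂ a) + ((haggLabel s m : ℝ) • barlowOffset a) +
      (z m • layerNormal 1))}
    (∀ p ∈ S, ‖p‖ ≤ R → ∃ i : Fin N, dist (x i + t) p ≤ ε) ∧
    (∀ i : Fin N, ‖x i + t‖ ≤ R → ∃ p ∈ S, dist (x i + t) p ≤ ε)

/-- Layered windows at every scale with ONE spacing, along the sequence `x` (the conclusion of
`NashHullBridge` for `x`, i.e. `HullMinimality.LayeredWindows` specialised to `x`). -/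
def LWConclusion (x : (N : ℕ) → (Fin N → E3)) : Prop :=
  ∃ a : ℝ, 47 / 50 ≤ a ∧ a ≤ 1 ∧ ∀ R ε : ℝ, 0 < ε → ∃ᶠ N in Filter.atTop, HasWindow (x N) a R ε

/-! ### The graded family -/

/-- The Nash near field AT ONE RESOLUTION `η`: the body of `NashClassCertificates.NashNearField` with its leading
`∀ η : ℝ, 0 < η →` removed (verbatim otherwise), so that `NashNearField` is definitionally
`∀ η, 0 < η → NashNearFieldAt η`. -/
def NashNearFieldAt (η : ℝ) : Prop :=
  ∃ c : ℝ, 0 < c ∧ ∃ C : ℝ, ∀ (N : ℕ) (x : Fin N → EuclideanSpace ℝ (Fin 3)), (∀ i j : Fin N, i ≠ j → 1 / 3 ≤ dist (x i) (x j)) → (∀ (i : Fin N) (y : EuclideanSpace ℝ (Fin 3)), (∀ j : Fin N, j ≠ i → y ≠ x j) → Literature.MathematicalPhysics.StatisticalMechanics.siteEnergy Literature.MathematicalPhysics.StatisticalMechanics.lennardJones x i ≤ ∑ j ∈ Finset.univ.erase i, Literature.MathematicalPhysics.StatisticalMechanics.lennardJones (dist y (x j))) → ∀ Ω : Finset (Fin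 N), (∀ i ∈ Ω, Literature.Geometry.DiscreteGeometry.IsTwoShellGood (1 / 20) (47 / 50) 1 x i) → c * (Nat.card {i : Fin N // i ∈ Ω ∧ ¬ (∃ (A : EuclideanSpace ℝ (Fin 3) →ₗᵢ[ℝ] EuclideanSpace ℝ (Fin 3)) (t : EuclideanSpace ℝ (Fin 3)) (a : ℝ) (s : ℤ → ℤ) (z : ℤ → ℝ), 47 / 50 ≤ a ∧ a ≤ 1 ∧ Literature.MathematicalPhysics.StatisticalMechanics.IsHaggSeq s ∧ (∀ m : ℤ, 39 / 50 * a ≤ z (m + 1) - z m ∧ z (m + 1) - z m ≤ 17 / 20 * a) ∧ let S : Set (EuclideanSpace ℝ (Fin 3)) := {p | ∃ m i j : ℤ, p = A (((i : ℝ) • Literature.MathematicalPhysics.StatisticalMechanics.triangularVec₁ a) + ((j : ℝ) • Literature.MathematicalPhysics.StatisticalMechanics.triangularVec₂ a) + ((Literature.MathematicalPhysics.StatisticalMechanics.haggLabel s m : ℝ) • Literature.MathematicalPhysics.StatisticalMechanics.barlowOffset a) + (z m • Literature.MathematicalPhysics.StatisticalMechanics.layerNormal 1))}; (∀ j : Fin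 N, dist (x j) (x i) ≤ 2 → ∃ p ∈ S, dist (x j + t) p ≤ η) ∧ (∀ p ∈ S, dist p (x i + t) ≤ 2 → ∃ j : Fin N, dist (x j + t) p ≤ η))} : ℝ) - C * (Nat.card {i : Fin N // i ∈ Ω ∧ ∃ j : Fin N, j ∉ Ω ∧ dist (x j) (x i) ≤ 4} : ℝ) ≤ ∑ i ∈ Ω, ((1 / 2 : ℝ) * (∑ j ∈ Finset.univ.erase i, Literature.MathematicalPhysics.StatisticalMechanics.lennardJones (dist (x i) (x j))) - (⨅ Q : Literature.MathematicalPhysics.StatisticalMechanics.PeriodicConfiguration 3, Q.energyPerParticle Literature.MathematicalPhysics.StatisticalMechanics.lennardJones))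

/-- `NashNearField` is, definitionally, the near field at every positive resolution. -/
theorem nashNearField_iff :
    NashClassCertificates.NashNearField ↔ ∀ η : ℝ, 0 < η → NashNearFieldAt η :=
  Iff.rfl

/-- **The graded family.** `Rung H`: the Nash-class two-shell gap and the Nash near field at the resolutions
`η ∈ H` give layered windows at every scale along every sequence of Lennard-Jones ground states.  Smaller `H`
= weaker hypothesis = STRONGER rung (`rung_mono`); `Rung (Set.Ioi 0)` is the floor `NashHullBridge`;
`Rung ∅` says that `NashTwoShellGap` ALONE gives the windows. -/
def Rung (H : Set ℝ) : Prop :=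
  NashClassCertificates.NashTwoShellGap → (∀ η ∈ H, NashNearFieldAt η) →
    ∀ x : (N : ℕ) → (Fin N → E3), (∀ N, IsGroundState lennardJones (x N)) → LWConclusion x

/-- **THE RUNG** (crux #1 of the line): the Nash near field at the SINGLE resolution `η₀ = 1/50` suffices — no
`∀ η > 0`, no rate `c(η)`, no flatness at ever finer scales. -/
def OneResolutionBridge : Prop :=
  Rung {(1 / 50 : ℝ)}

/-- The family is graded: fewer resolutions assumed, stronger rung. -/
theorem rung_mono {H H' : Set ℝ} (h : H ⊆ H') : Rung H → Rung H' :=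
  fun hR hG hNF => hR hG fun η hη => hNF η (h hη)

/-- **SPECIAL CASE = THE FLOOR** (F3): `Rung (Set.Ioi 0)` is the proved bridge `nashHullBridge_proof`
(definitional unfolding only). -/
theorem rung_floor : Rung (Set.Ioi 0) :=
  fun hG hNF x hx => LayeredWindowsLocal.nashHullBridge_proof hG (fun η hη => hNF η hη) x hx

/-- The floor member of the family is `NashHullBridge` verbatim. -/
theorem rung_floor_iff : Rung (Set.Ioi 0) ↔ NashClassCertificates.NashHullBridge :=
  ⟨fun h hG hNF x hx => h hG (fun η hη => hNF η hη) x hx,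
   fun h hG hNF x hx => h hG (fun η hη => hNF η hη) x hx⟩

/-- **rung ⇒ floor** (`{1/50} ⊆ Set.Ioi 0`). -/
theorem oneResolutionBridge_imp_floor : OneResolutionBridge → Rung (Set.Ioi 0) :=
  rung_mono (Set.singleton_subset_iff.2 (by norm_num))

/-- **On path**: the route's thesis `HullMinimality.LayeredWindows` gives every member of the family (so
`S → thesis → rung`; the rung is a rung, not the summit). -/
theorem rung_of_layeredWindows (H : Set ℝ) (hLW : HullMinimality.LayeredWindows) : Rung H :=
  fun _ _ x hx => hLW x hx


/-- F3 witness restated as an `example`: the floor of the family is the seed theorem. -/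
example : Rung (Set.Ioi 0) := rung_floor

/-- … and the proved bridge is recovered from the rung. -/
example (h : OneResolutionBridge) : NashClassCertificates.NashHullBridge :=
  rung_floor_iff.1 (oneResolutionBridge_imp_floor h)

end Summit.AtomisticToContinuum.Crystallization.Cruxes.NashNearField.OneResolution

end
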